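import Summits.ResolutionOfSingularities.ResolutionOfSingularities.Theorems.FrobeniusLadderFRationalResolutionSingBlowupRound
import HarnessLib

/-!
# Crux `FrobeniusLadder.FRationalResolution` (stmt-ResolutionOfSingularities-15317), line `redirect`,
# stub `stub_diagonalizableQuotientResolution` — **rank-2 strata of measure `d ≤ 3` are resolved by ONE intrinsic
# blow-up `Bl_{𝓘_{Sing X}} X`, over every field, in every dimension, isolated or not** (design C3 = the rank-2 stratum
# layer of the non-isolated case: the induction L4 in its base instance; the general `d` adds only the propagation of
# the pointwise singular-locus description `hSing` to the charts of the round)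

* `mem_regularLocus_of_isBlowup_singularLocusIdeal` — a blowing up along `𝓘_{Sing X}` is regular over `Reg X`
  (`IsBlowup.isIso_compl`);
* **`hasResolution_of_measure_le_three`** — if every singular point of the integral `X` (locally of finite type over
  a field `k`) carries lineage 2's rank-2 stratum invariant (`…SingBlowupRound.exists_chart_of_singular_point`: base
  chart log regular along the stratum, cone chart algebra in normal form with measure `a < d`, fixed prime, étale roof,
  pointwise singular-locus description) with `d ≤ 3`, then `X` has a resolution of singularities — namely
  `Bl_{𝓘_{Sing X}} X → X` (`singBlowup`, proper and birational, tree `LipmanProcedure`): a singular point of the blow-up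
  would be the fixed point of a chart with `2 ≤ c ≤ d − 2 ≤ 1`.

Honest label: assembly toward ONE leaf stub (no stub, crux or summit closed). No definitions, no named facts, no sorry.
[cite: Kato1994, (10.1), (10.3)] [cite: Liu2002, §8.3.4, (3.11)] [cite: GortzWedhorn2020, Prop. 13.91]
-/

noncomputable section

-- single-problem summit: the doubled namespace component is forced
set_option linter.dupNamespace false

open CategoryTheory CategoryTheory.Limits AlgebraicGeometry TopologicalSpace
open IsLocalRing Literature.AlgebraicGeometry.Resolution Literature.AlgebraicGeometry.Resolution.LogChart
open Summit.ResolutionOfSingularities.ResolutionOfSingularities.Theorems.FRationalResolution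

namespace Summit.ResolutionOfSingularities.ResolutionOfSingularities.Theorems.FRationalResolution.SingBlowupLowMeasure

/-- **A blowing up along `𝓘_{Sing X}` is regular over the regular locus** (it is an isomorphism there).
[cite: GortzWedhorn2020, Prop. 13.91 (3)] -/
theorem mem_regularLocus_of_isBlowup_singularLocusIdeal {k : Type} [Field k] {X X₁ : Scheme.{0}}
    (f : X ⟶ Spec (.of k)) [LocallyOfFiniteType f] {π : X₁ ⟶ X} (hπ : IsBlowup π (singularLocusIdeal X f))
    (x₁ : X₁) (hx : π x₁ ∈ Scheme.regularLocus X) : x₁ ∈ Scheme.regularLocus X₁ := by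
  set U : X.Opens := ⟨((singularLocusIdeal X f).support : Set X)ᶜ,
    (singularLocusIdeal X f).support.isClosed.isOpen_compl⟩ with hUdef
  have hU : (U : Set X) = Scheme.regularLocus X := by
    rw [hUdef]
    show ((singularLocusIdeal X f).support : Set X)ᶜ = Scheme.regularLocus X
    rw [coe_support_singularLocusIdeal, compl_compl]
  haveI : IsIso (π ∣_ U) := hπ.isIso_compl
  have hx₁U : x₁ ∈ π ⁻¹ᵁ U := by
    show π x₁ ∈ (U : Set X)
    rw [hU]; exact hx
  let jU : ((π ⁻¹ᵁ U : X₁.Opens) : Scheme.{0}) ⟶ X := (π ⁻¹ᵁ U).ι ≫ π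
  have hj : jU = (π ∣_ U) ≫ U.ι := (morphismRestrict_ι π U).symm
  haveI : IsOpenImmersion jU := by rw [hj]; infer_instance
  have h1 := (mem_regularLocus_iff_of_flat_of_isPreimmersion jU ⟨x₁, hx₁U⟩).mpr (by
    have : jU ⟨x₁, hx₁U⟩ = π x₁ := by
      show π ((π ⁻¹ᵁ U).ι ⟨x₁, hx₁U⟩) = π x₁
      rw [Scheme.Opens.ι_apply]
    rw [this]; exact hx)
  have h2 := (mem_regularLocus_iff_of_flat_of_isPreimmersion (π ⁻¹ᵁ U).ι ⟨x₁, hx₁U⟩).mp h1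
  rwa [Scheme.Opens.ι_apply] at h2

set_option maxHeartbeats 800000 in
/-- **Rank-2 strata of measure `d ≤ 3` are resolved by the single intrinsic blow-up `Bl_{𝓘_{Sing X}} X`.** See the
module docstring. [cite: Kato1994, (10.1), (10.3)] [cite: Liu2002, §8.3.4, (3.11)] -/
theorem hasResolution_of_measure_le_three {k : Type} [Field k] (X : Scheme.{0}) [IsIntegral X]
    (f : X ⟶ Spec (.of k)) [LocallyOfFiniteType f]
    (H : ∀ x : X, x ∉ Scheme.regularLocus X →
      ∃ (A : Type) (_ : CommRing A) (_ : IsNoetherianRing A) (n : ℕ) (P : AddSubmonoid (Fin n → ℤ))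
        (φ : Multiplicative P →* A) (𝔭 : Ideal A) (_ : 𝔭.IsPrime) (C : Type) (_ : CommRing C) (_ : Algebra A C)
        (_ : IsNoetherianRing C) (Q : AddSubmonoid (Fin n → ℤ)) (χ : Multiplicative Q →* C) (u e : Fin n → ℤ)
        (a d : ℕ), a < d ∧ d ≤ 3 ∧ P.FG ∧
        (∀ (w : Fin n → ℤ) (k : ℕ), 0 < k → k • w ∈ P → w ∈ P) ∧
        Submodule.span ℤ (P : Set (Fin n → ℤ)) = ⊤ ∧ IsLogRegularAt P φ 𝔭 ∧
        ∃ (hPQ : P ≤ Q),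
        (∀ p : P, χ (Multiplicative.ofAdd ⟨(p : Fin n → ℤ), hPQ p.2⟩) =
          algebraMap A C (φ (Multiplicative.ofAdd p))) ∧
        Algebra.adjoin A (Set.range χ) = ⊤ ∧
        (∀ q ∈ Q, ∃ p ∈ P, q + p ∈ P) ∧
        (∀ a : A, algebraMap A C a = 0 → ∃ p : P, φ (Multiplicative.ofAdd p) * a = 0) ∧
        (∀ (K : Type) [Field K] (g : A →+* K), (∀ p : P, g (φ (Multiplicative.ofAdd p)) ≠ 0) →
          ∃ ω : C →+* K, ω.comp (algebraMap A C) = g) ∧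
        Q.FG ∧
        (∀ w, w ∈ Q ↔ ∃ g ∈ Submodule.span ℤ (faceMonoid P φ 𝔭 : Set (Fin n → ℤ)), ∃ m l : ℤ,
          0 ≤ l ∧ (a : ℤ) * l ≤ (d : ℤ) * m ∧ w = g + m • u + l • e) ∧
        (∀ g ∈ Submodule.span ℤ (faceMonoid P φ 𝔭 : Set (Fin n → ℤ)), ∀ m l : ℤ,
          g + m • u + l • e = 0 → m = 0 ∧ l = 0) ∧
        (∀ w : Fin n → ℤ, ∃ g ∈ Submodule.span ℤ (faceMonoid P φ 𝔭 : Set (Fin n → ℤ)),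
          ∃ m l : ℤ, w = g + m • u + l • e) ∧
        (∀ (𝔮 : Ideal A) [𝔮.IsPrime], 𝔮 ≤ 𝔭 → ideal P φ 𝔭 ≤ 𝔮 → IsLogRegularAt P φ 𝔮) ∧
        n - Module.finrank ℤ (Submodule.span ℤ (faceMonoid P φ 𝔭 : Set (Fin n → ℤ))) ≤ 2 ∧
        ∃ (𝔓 : Ideal C) (_ : 𝔓.IsPrime), 𝔓.comap (algebraMap A C) = 𝔭 ∧
          (∀ q : Q, (q : Fin n → ℤ) ∉ Submodule.span ℤ (faceMonoid P φ 𝔭 : Set (Fin n → ℤ)) →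
            χ (Multiplicative.ofAdd q) ∈ 𝔓) ∧
          ∃ (Y : Scheme.{0}) (ρ : Y ⟶ X) (_ : Etale ρ) (j : Y ⟶ Spec (.of C)) (_ : IsOpenImmersion j) (y : Y),
            ρ y = x ∧ (j y).asIdeal = 𝔓 ∧
            ∀ y' : Y, ¬ IsRegularLocalRing (Localization.AtPrime (j y').asIdeal) ↔
              ideal Q χ 𝔓 ≤ (j y').asIdeal) :
    Scheme.HasResolution X := by
  have hreg₁ : Scheme.IsRegular (singBlowup X f) := by
    intro x₁
    by_contra hx₁
    have hx₁' : x₁ ∉ Scheme.regularLocus (singBlowup X f) := hx₁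
    by_cases hx : singBlowup.π X f x₁ ∈ Scheme.regularLocus X
    · exact hx₁' (mem_regularLocus_of_isBlowup_singularLocusIdeal f (blowup.isBlowup _) x₁ hx)
    · obtain ⟨A, _, _, n, P, φ, 𝔭, _, C, _, _, _, Q, χ, u, e, a, d, had, hd3, hP, hsat, hspanP, hreg, hPQ, hχ, hgen,
        hD, hK, hΩ, hQfg, hQ, hind, hspan, hreg', hrank, 𝔓, _, h𝔓A, h𝔓q, Y, ρ, _, j, _, y, hρy, hjy, hSing⟩ :=
        H _ hx
      obtain ⟨s, -, -, -, -, h, hhQ, -, v, x, c, hc2, hcd, -⟩ :=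
        SingBlowupRound.exists_chart_of_singular_point f (blowup.isBlowup _) had hP hsat hspanP hreg hPQ hχ hgen
          hD hK hΩ hQfg hQ hind hspan hreg' hrank 𝔓 h𝔓A h𝔓q ρ j y hjy hSing x₁ hρy.symm hx₁'
      omega
  exact ⟨_, singBlowup.π X f, ⟨inferInstance, singBlowup.isBirational X f, hreg₁⟩⟩

end Summit.ResolutionOfSingularities.ResolutionOfSingularities.Theorems.FRationalResolution.SingBlowupLowMeasure

end
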